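import Mathlib
import Summits.ValiantsHypothesis.ValiantsHypothesis.Theorems.ElementaryWordLengthWordLengthQPStubKappaTwoStructureAux
import Summits.ValiantsHypothesis.ValiantsHypothesis.Theorems.ElementaryWordLengthWordLengthQPStubKappaTwoStructureAuxB
import Summits.ValiantsHypothesis.ValiantsHypothesis.Theorems.ElementaryWordLengthWordLengthQPStubKappaTwoStructureAuxC

/-!
# Crux `WordLengthQP` (stmt-ValiantsHypothesis-6623), line `positive-monoid-exits` —
helpers for stub `stub_kappaTwoStructure`, part D: the SKELETON of a word and its FIRST-ORDER
terms.

For a word `w` computing `E₀₂(F)` where every monomial of `F` has degree `≥ 2`: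
* the skeleton `W̄ = ∏ 𝕄c(l)` (constant coefficients: `E_ij(c x_v) ↦ 1`, `E_ij(c) ↦ E_ij(c)`) is
  the identity matrix (`k2_cc_prod`, `k2_cc_far`);
* for every variable `v`, `∂_v W |₀ = Σ_k Ḡ_{<k} (c_k [v_k = v] e_{i_k j_k}) Ḡ_{>k}` vanishes
  (`k2_Dm_prod_cons`, `k2Dm_far`), and the KILL LEMMA `k2_kill` turns this into: if a bilinear
  test `X ↦ (Λ X Ρ)ᵣₛ` is nonnegative on every term then every term's test is zero.
-/

set_option linter.dupNamespace false

noncomputable section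

namespace Summit.ValiantsHypothesis.ValiantsHypothesis.Cruxes.WordLengthQP.PositiveMonoidExits

open MvPolynomial

/-! ## Skeleton letters and first-order derivative at `0` -/

/-- Constant coefficients of a letter matrix. [folklore] -/
theorem k2_cc_letter {σ : Type} (l : Fin 3 × Fin 3 × ℝ × Option σ) :
    ((Matrix.transvection (Prod.fst l) (Prod.fst (Prod.snd l)) (MvPolynomial.C (Prod.fst (Prod.snd (Prod.snd l))) * Option.elim (Prod.snd (Prod.snd (Prod.snd l))) 1 MvPolynomial.X) : Matrix (Fin 3) (Fin 3) (MvPolynomial σ ℝ))).map MvPolynomial.constantCoeff = (Matrix.transvection (Prod.fst l) (Prod.fst (Prod.snd l)) (Option.elim (Prod.snd (Prod.snd (Prod.snd l))) (Prod.fst (Prod.snd (Prod.snd l))) (fun _ => (0 : ℝ))) : Matrix (Fin 3) (Fin 3) ℝ) := by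
  rcases l with ⟨i, j, c, _ | v⟩ <;>
  · simp [Matrix.transvection, Matrix.map_add, Matrix.map_one]

/-- Constant coefficients of a product of letters. [folklore] -/
theorem k2_cc_prod {σ : Type} (A : List (Fin 3 × Fin 3 × ℝ × Option σ)) :
    ((A.map (fun l => (Matrix.transvection (Prod.fst l) (Prod.fst (Prod.snd l)) (MvPolynomial.C (Prod.fst (Prod.snd (Prod.snd l))) * Option.elim (Prod.snd (Prod.snd (Prod.snd l))) 1 MvPolynomial.X) : Matrix (Fin 3) (Fin 3) (MvPolynomial σ ℝ)))).prod).map MvPolynomial.constantCoeff = (A.map (fun l => (Matrix.transvection (Prod.fst l) (Prod.fst (Prod.snd l)) (Option.elim (Prod.snd (Prod.snd (Prod.snd l))) (Prod.fst (Prod.snd (Prod.snd l))) (fun _ => (0 : ℝ))) : Matrix (Fin 3) (Fin 3) ℝ))).prod := by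
  have := map_list_prod (MvPolynomial.constantCoeff (R := ℝ) (σ := σ)).mapMatrix (A.map (fun l => (Matrix.transvection (Prod.fst l) (Prod.fst (Prod.snd l)) (MvPolynomial.C (Prod.fst (Prod.snd (Prod.snd l))) * Option.elim (Prod.snd (Prod.snd (Prod.snd l))) 1 MvPolynomial.X) : Matrix (Fin 3) (Fin 3) (MvPolynomial σ ℝ))))
  rw [RingHom.mapMatrix_apply] at this
  rw [this, List.map_map]
  congr 1
  refine List.map_congr_left fun l _ => ?_
  simp only [Function.comp_apply, RingHom.mapMatrix_apply, k2_cc_letter]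

/-- `E₀₂(F)` has identity skeleton when `F` has no constant term. [folklore] -/
theorem k2_cc_far {σ : Type} (F : MvPolynomial σ ℝ) (h : ∀ m ∈ F.support, 1 ≤ Finsupp.degree m) :
    (Matrix.transvection (0 : Fin 3) 2 F).map MvPolynomial.constantCoeff = 1 := by
  have hF : MvPolynomial.constantCoeff F = 0 := by
    rw [constantCoeff_eq]
    by_contra hne
    have := h 0 (by simpa [MvPolynomial.mem_support_iff] using hne)
    simp at this
  simp [Matrix.transvection, Matrix.map_add, Matrix.map_one, hF]

/-- Leibniz rule at `0`. [folklore] -/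
theorem k2D_mul {σ : Type} (v : σ) (p q : MvPolynomial σ ℝ) :
    MvPolynomial.constantCoeff (MvPolynomial.pderiv v (p * q)) = MvPolynomial.constantCoeff p * MvPolynomial.constantCoeff (MvPolynomial.pderiv v (q)) + MvPolynomial.constantCoeff (MvPolynomial.pderiv v (p)) * MvPolynomial.constantCoeff q := by
  simp only [Derivation.leibniz, smul_eq_mul, map_add, map_mul]; ring

/-- `∂_v(c x_v)|₀ = c`. [folklore] -/
theorem k2D_CX_self {σ : Type} (v : σ) (c : ℝ) : MvPolynomial.constantCoeff (MvPolynomial.pderiv v ((C c * X v : MvPolynomial σ ℝ))) = c := by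
  classical
  simp [pderiv_X]

/-- `∂_v(c x_w)|₀ = 0` for `w ≠ v`. [folklore] -/
theorem k2D_CX_ne {σ : Type} (v w : σ) (h : w ≠ v) (c : ℝ) :
    MvPolynomial.constantCoeff (MvPolynomial.pderiv v ((C c * X w : MvPolynomial σ ℝ))) = 0 := by
  classical
  simp [pderiv_X, h]

/-- `∂_v(c)|₀ = 0`. [folklore] -/
theorem k2D_C {σ : Type} (v : σ) (c : ℝ) : MvPolynomial.constantCoeff (MvPolynomial.pderiv v ((C c : MvPolynomial σ ℝ))) = 0 := by
  simp

/-- `∂_v(c · 1)|₀ = 0`. [folklore] -/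
theorem k2D_C1 {σ : Type} (v : σ) (c : ℝ) : MvPolynomial.constantCoeff (MvPolynomial.pderiv v ((C c * 1 : MvPolynomial σ ℝ))) = 0 := by
  simp

/-- `∂_v F|₀ = 0` when every monomial of `F` has degree `≥ 2`. [folklore] -/
theorem k2D_eq_zero_of_degree {σ : Type} (v : σ) (F : MvPolynomial σ ℝ)
    (h : ∀ m ∈ F.support, 2 ≤ Finsupp.degree m) : MvPolynomial.constantCoeff (MvPolynomial.pderiv v (F)) = 0 := by
  classical
  rw [F.as_sum, map_sum, map_sum]
  refine Finset.sum_eq_zero fun m hm => ?_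
  rw [pderiv_monomial, constantCoeff_monomial]
  split_ifs with h0
  · exfalso
    have h2 := h m hm
    have hle : m ≤ Finsupp.single v 1 := tsub_eq_zero_iff_le.mp h0
    obtain ⟨k, hk⟩ := exists_add_of_le hle
    have hd := congrArg Finsupp.degree hk
    rw [Finsupp.degree_single, map_add] at hd
    omega
  · rfl

/-- Matrix Leibniz rule at `0`. [folklore] -/
theorem k2Dm_mul {σ : Type} (v : σ) (A B : Matrix (Fin 3) (Fin 3) (MvPolynomial σ ℝ)) :
    (Matrix.map (A * B) (fun p => MvPolynomial.constantCoeff (MvPolynomial.pderiv v p)) : Matrix (Fin 3) (Fin 3) ℝ) = (Matrix.map (A) (fun p => MvPolynomial.constantCoeff (MvPolynomial.pderiv v p)) : Matrix (Fin 3) (Fin 3) ℝ) * B.map MvPolynomial.constantCoeff +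
      A.map MvPolynomial.constantCoeff * (Matrix.map (B) (fun p => MvPolynomial.constantCoeff (MvPolynomial.pderiv v p)) : Matrix (Fin 3) (Fin 3) ℝ) := by
  ext i j
  simp only [Matrix.map_apply, Matrix.mul_apply, Matrix.add_apply]
  rw [map_sum, map_sum, Finset.sum_congr rfl (fun k _ => k2D_mul v (A i k) (B k j)),
    Finset.sum_add_distrib, add_comm]

/-- `∂_v|₀` of a letter: `c · e_ij` for the variable letter `E_ij(c x_v)`, else `0`. [folklore] -/
theorem k2Dm_letter {σ : Type} [DecidableEq σ] (v : σ) (l : Fin 3 × Fin 3 × ℝ × Option σ) :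
    (Matrix.map ((Matrix.transvection (Prod.fst l) (Prod.fst (Prod.snd l)) (MvPolynomial.C (Prod.fst (Prod.snd (Prod.snd l))) * Option.elim (Prod.snd (Prod.snd (Prod.snd l))) 1 MvPolynomial.X) : Matrix (Fin 3) (Fin 3) (MvPolynomial σ ℝ))) (fun p => MvPolynomial.constantCoeff (MvPolynomial.pderiv v p)) : Matrix (Fin 3) (Fin 3) ℝ) = Matrix.single l.1 l.2.1 (if l.2.2.2 = some v then l.2.2.1 else 0) := by
  rcases l with ⟨i, j, c, _ | w⟩
  · rw [if_neg (by simp)]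
    ext a b
    simp only [Matrix.map_apply, Matrix.transvection, Matrix.add_apply,
      Matrix.one_apply, Matrix.single_apply, Option.elim_none, map_add]
    split_ifs <;> simp
  · by_cases hw : w = v
    · subst hw
      rw [if_pos rfl]
      ext a b
      simp only [Matrix.map_apply, Matrix.transvection, Matrix.add_apply,
        Matrix.one_apply, Matrix.single_apply, Option.elim_some, map_add]
      split_ifs <;> simp [pderiv_X]
    · rw [if_neg (by simpa using hw)]
      ext a b
      simp only [Matrix.map_apply, Matrix.transvection, Matrix.add_apply,
        Matrix.one_apply, Matrix.single_apply, Option.elim_some, map_add]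
      split_ifs <;> simp [pderiv_X, hw]

/-- `∂_v|₀ E₀₂(F) = 0` when every monomial of `F` has degree `≥ 2`. [folklore] -/
theorem k2Dm_far {σ : Type} (v : σ) (F : MvPolynomial σ ℝ)
    (h : ∀ m ∈ F.support, 2 ≤ Finsupp.degree m) :
    (Matrix.map (Matrix.transvection (0 : Fin 3) 2 F) (fun p => MvPolynomial.constantCoeff (MvPolynomial.pderiv v p)) : Matrix (Fin 3) (Fin 3) ℝ) = 0 := by
  have hF := k2D_eq_zero_of_degree v F h
  ext a b
  simp only [Matrix.map_apply, Matrix.transvection, Matrix.add_apply, Matrix.one_apply,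
    Matrix.single_apply, map_add, Matrix.zero_apply]
  split_ifs <;> simp [hF]

/-- `∂_v|₀ 1 = 0`. [folklore] -/
theorem k2Dm_one {σ : Type} (v : σ) :
    (Matrix.map ((1 : Matrix (Fin 3) (Fin 3) (MvPolynomial σ ℝ))) (fun p => MvPolynomial.constantCoeff (MvPolynomial.pderiv v p)) : Matrix (Fin 3) (Fin 3) ℝ) = 0 := by
  ext a b
  simp only [Matrix.map_apply, Matrix.one_apply, Matrix.zero_apply]
  split_ifs <;> simp

/-- The bilinear test `(P e_ij(d) N)ᵣₛ = Pᵣᵢ d Nⱼₛ`. [folklore] -/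
theorem k2_test_single (P N : Matrix (Fin 3) (Fin 3) ℝ) (i j r s : Fin 3) (d : ℝ) :
    (P * Matrix.single i j d * N) r s = P r i * d * N j s := by
  fin_cases i <;> fin_cases j <;>
    simp [Matrix.mul_apply, Fin.sum_univ_three, Matrix.single_apply]

/-! ## The first-order sum and the kill lemma -/

/-- First-order expansion of a product of letters (cons step). [folklore] -/
theorem k2_Dm_prod_cons {σ : Type} [DecidableEq σ] (v : σ) (l : Fin 3 × Fin 3 × ℝ × Option σ)
    (w : List (Fin 3 × Fin 3 × ℝ × Option σ)) :
    (Matrix.map (((l :: w).map (fun l => (Matrix.transvection (Prod.fst l) (Prod.fst (Prod.snd l)) (MvPolynomial.C (Prod.fst (Prod.snd (Prod.snd l))) * Option.elim (Prod.snd (Prod.snd (Prod.snd l))) 1 MvPolynomial.X) : Matrix (Fin 3) (Fin 3) (MvPolynomial σ ℝ)))).prod) (fun p => MvPolynomial.constantCoeff (MvPolynomial.pderiv v p)) : Matrix (Fin 3) (Fin 3) ℝ) =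
      Matrix.single l.1 l.2.1 (if l.2.2.2 = some v then l.2.2.1 else 0) * (w.map (fun l => (Matrix.transvection (Prod.fst l) (Prod.fst (Prod.snd l)) (Option.elim (Prod.snd (Prod.snd (Prod.snd l))) (Prod.fst (Prod.snd (Prod.snd l))) (fun _ => (0 : ℝ))) : Matrix (Fin 3) (Fin 3) ℝ))).prod +
        (Matrix.transvection (Prod.fst l) (Prod.fst (Prod.snd l)) (Option.elim (Prod.snd (Prod.snd (Prod.snd l))) (Prod.fst (Prod.snd (Prod.snd l))) (fun _ => (0 : ℝ))) : Matrix (Fin 3) (Fin 3) ℝ) * (Matrix.map ((w.map (fun l => (Matrix.transvection (Prod.fst l) (Prod.fst (Prod.snd l)) (MvPolynomial.C (Prod.fst (Prod.snd (Prod.snd l))) * Option.elim (Prod.snd (Prod.snd (Prod.snd l))) 1 MvPolynomial.X) : Matrix (Fin 3) (Fin 3) (MvPolynomial σ ℝ)))).prod) (fun p => MvPolynomial.constantCoeff (MvPolynomial.pderiv v p)) : Matrix (Fin 3) (Fin 3) ℝ) := by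
  rw [List.map_cons, List.prod_cons, k2Dm_mul, k2Dm_letter, k2_cc_prod, k2_cc_letter]

/-- **Kill lemma.** If the bilinear test `X ↦ (Λ X Ρ)ᵣₛ` is nonnegative on every first-order
term `Ḡ_{<k} (c_k e_{i_k j_k}) Ḡ_{>k}` (`v_k = v`) of a word, then the test of `∂_v W|₀` is
nonnegative; if moreover the latter vanishes, every term's test vanishes. [folklore] -/
theorem k2_kill {σ : Type} [DecidableEq σ] (v : σ) (w : List (Fin 3 × Fin 3 × ℝ × Option σ))
    (Λ Ρ : Matrix (Fin 3) (Fin 3) ℝ) (r s : Fin 3)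
    (hnn : ∀ (A : List _) (l : Fin 3 × Fin 3 × ℝ × Option σ) (B : List _), w = A ++ l :: B →
      l.2.2.2 = some v →
      0 ≤ (Λ * (A.map (fun l => (Matrix.transvection (Prod.fst l) (Prod.fst (Prod.snd l)) (Option.elim (Prod.snd (Prod.snd (Prod.snd l))) (Prod.fst (Prod.snd (Prod.snd l))) (fun _ => (0 : ℝ))) : Matrix (Fin 3) (Fin 3) ℝ))).prod) r l.1 * l.2.2.1 * ((B.map (fun l => (Matrix.transvection (Prod.fst l) (Prod.fst (Prod.snd l)) (Option.elim (Prod.snd (Prod.snd (Prod.snd l))) (Prod.fst (Prod.snd (Prod.snd l))) (fun _ => (0 : ℝ))) : Matrix (Fin 3) (Fin 3) ℝ))).prod * Ρ) l.2.1 s) :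
    0 ≤ (Λ * (Matrix.map ((w.map (fun l => (Matrix.transvection (Prod.fst l) (Prod.fst (Prod.snd l)) (MvPolynomial.C (Prod.fst (Prod.snd (Prod.snd l))) * Option.elim (Prod.snd (Prod.snd (Prod.snd l))) 1 MvPolynomial.X) : Matrix (Fin 3) (Fin 3) (MvPolynomial σ ℝ)))).prod) (fun p => MvPolynomial.constantCoeff (MvPolynomial.pderiv v p)) : Matrix (Fin 3) (Fin 3) ℝ) * Ρ) r s ∧
    ((Λ * (Matrix.map ((w.map (fun l => (Matrix.transvection (Prod.fst l) (Prod.fst (Prod.snd l)) (MvPolynomial.C (Prod.fst (Prod.snd (Prod.snd l))) * Option.elim (Prod.snd (Prod.snd (Prod.snd l))) 1 MvPolynomial.X) : Matrix (Fin 3) (Fin 3) (MvPolynomial σ ℝ)))).prod) (fun p => MvPolynomial.constantCoeff (MvPolynomial.pderiv v p)) : Matrix (Fin 3) (Fin 3) ℝ) * Ρ) r s = 0 →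
      ∀ (A : List _) (l : Fin 3 × Fin 3 × ℝ × Option σ) (B : List _), w = A ++ l :: B →
        l.2.2.2 = some v →
        (Λ * (A.map (fun l => (Matrix.transvection (Prod.fst l) (Prod.fst (Prod.snd l)) (Option.elim (Prod.snd (Prod.snd (Prod.snd l))) (Prod.fst (Prod.snd (Prod.snd l))) (fun _ => (0 : ℝ))) : Matrix (Fin 3) (Fin 3) ℝ))).prod) r l.1 * l.2.2.1 * ((B.map (fun l => (Matrix.transvection (Prod.fst l) (Prod.fst (Prod.snd l)) (Option.elim (Prod.snd (Prod.snd (Prod.snd l))) (Prod.fst (Prod.snd (Prod.snd l))) (fun _ => (0 : ℝ))) : Matrix (Fin 3) (Fin 3) ℝ))).prod * Ρ) l.2.1 s = 0) := by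
  induction w generalizing Λ with
  | nil =>
    refine ⟨by simp [k2Dm_one], fun _ A l B h => ?_⟩
    exact absurd h (by simp)
  | cons l0 w ih =>
    -- the head term and the tail
    have hhead : (Λ * (Matrix.single l0.1 l0.2.1 (if l0.2.2.2 = some v then l0.2.2.1 else 0) *
        (w.map (fun l => (Matrix.transvection (Prod.fst l) (Prod.fst (Prod.snd l)) (Option.elim (Prod.snd (Prod.snd (Prod.snd l))) (Prod.fst (Prod.snd (Prod.snd l))) (fun _ => (0 : ℝ))) : Matrix (Fin 3) (Fin 3) ℝ))).prod) * Ρ) r s =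
        (Λ * (([] : List (Fin 3 × Fin 3 × ℝ × Option σ)).map (fun l => (Matrix.transvection (Prod.fst l) (Prod.fst (Prod.snd l)) (Option.elim (Prod.snd (Prod.snd (Prod.snd l))) (Prod.fst (Prod.snd (Prod.snd l))) (fun _ => (0 : ℝ))) : Matrix (Fin 3) (Fin 3) ℝ))).prod) r l0.1 * (if l0.2.2.2 = some v then l0.2.2.1 else 0) *
          ((w.map (fun l => (Matrix.transvection (Prod.fst l) (Prod.fst (Prod.snd l)) (Option.elim (Prod.snd (Prod.snd (Prod.snd l))) (Prod.fst (Prod.snd (Prod.snd l))) (fun _ => (0 : ℝ))) : Matrix (Fin 3) (Fin 3) ℝ))).prod * Ρ) l0.2.1 s := by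
      rw [List.map_nil, List.prod_nil, mul_one,
        show Λ * (Matrix.single l0.1 l0.2.1 (if l0.2.2.2 = some v then l0.2.2.1 else 0) *
          (w.map (fun l => (Matrix.transvection (Prod.fst l) (Prod.fst (Prod.snd l)) (Option.elim (Prod.snd (Prod.snd (Prod.snd l))) (Prod.fst (Prod.snd (Prod.snd l))) (fun _ => (0 : ℝ))) : Matrix (Fin 3) (Fin 3) ℝ))).prod) * Ρ = Λ * Matrix.single l0.1 l0.2.1
            (if l0.2.2.2 = some v then l0.2.2.1 else 0) * ((w.map (fun l => (Matrix.transvection (Prod.fst l) (Prod.fst (Prod.snd l)) (Option.elim (Prod.snd (Prod.snd (Prod.snd l))) (Prod.fst (Prod.snd (Prod.snd l))) (fun _ => (0 : ℝ))) : Matrix (Fin 3) (Fin 3) ℝ))).prod * Ρ) by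
          simp only [Matrix.mul_assoc], k2_test_single]
    have hhead0 : 0 ≤ (Λ * (([] : List (Fin 3 × Fin 3 × ℝ × Option σ)).map (fun l => (Matrix.transvection (Prod.fst l) (Prod.fst (Prod.snd l)) (Option.elim (Prod.snd (Prod.snd (Prod.snd l))) (Prod.fst (Prod.snd (Prod.snd l))) (fun _ => (0 : ℝ))) : Matrix (Fin 3) (Fin 3) ℝ))).prod) r l0.1 * (if l0.2.2.2 = some v then l0.2.2.1 else 0) *
          ((w.map (fun l => (Matrix.transvection (Prod.fst l) (Prod.fst (Prod.snd l)) (Option.elim (Prod.snd (Prod.snd (Prod.snd l))) (Prod.fst (Prod.snd (Prod.snd l))) (fun _ => (0 : ℝ))) : Matrix (Fin 3) (Fin 3) ℝ))).prod * Ρ) l0.2.1 s := by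
      by_cases hv : l0.2.2.2 = some v
      · rw [if_pos hv]; exact hnn [] l0 w rfl hv
      · rw [if_neg hv]; simp
    have ih' := ih (Λ * (Matrix.transvection (Prod.fst l0) (Prod.fst (Prod.snd l0)) (Option.elim (Prod.snd (Prod.snd (Prod.snd l0))) (Prod.fst (Prod.snd (Prod.snd l0))) (fun _ => (0 : ℝ))) : Matrix (Fin 3) (Fin 3) ℝ)) (fun A l B h hv => by
      have := hnn (l0 :: A) l B (by rw [h]; rfl) hv
      simpa only [List.map_cons, List.prod_cons, Matrix.mul_assoc] using this)
    have hsplit : (Λ * (Matrix.map (((l0 :: w).map (fun l => (Matrix.transvection (Prod.fst l) (Prod.fst (Prod.snd l)) (MvPolynomial.C (Prod.fst (Prod.snd (Prod.snd l))) * Option.elim (Prod.snd (Prod.snd (Prod.snd l))) 1 MvPolynomial.X) : Matrix (Fin 3) (Fin 3) (MvPolynomial σ ℝ)))).prod) (fun p => MvPolynomial.constantCoeff (MvPolynomial.pderiv v p)) : Matrix (Fin 3) (Fin 3) ℝ) * Ρ) r s =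
        (Λ * (([] : List (Fin 3 × Fin 3 × ℝ × Option σ)).map (fun l => (Matrix.transvection (Prod.fst l) (Prod.fst (Prod.snd l)) (Option.elim (Prod.snd (Prod.snd (Prod.snd l))) (Prod.fst (Prod.snd (Prod.snd l))) (fun _ => (0 : ℝ))) : Matrix (Fin 3) (Fin 3) ℝ))).prod) r l0.1 * (if l0.2.2.2 = some v then l0.2.2.1 else 0) *
          ((w.map (fun l => (Matrix.transvection (Prod.fst l) (Prod.fst (Prod.snd l)) (Option.elim (Prod.snd (Prod.snd (Prod.snd l))) (Prod.fst (Prod.snd (Prod.snd l))) (fun _ => (0 : ℝ))) : Matrix (Fin 3) (Fin 3) ℝ))).prod * Ρ) l0.2.1 s +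
        (Λ * (Matrix.transvection (Prod.fst l0) (Prod.fst (Prod.snd l0)) (Option.elim (Prod.snd (Prod.snd (Prod.snd l0))) (Prod.fst (Prod.snd (Prod.snd l0))) (fun _ => (0 : ℝ))) : Matrix (Fin 3) (Fin 3) ℝ) * (Matrix.map ((w.map (fun l => (Matrix.transvection (Prod.fst l) (Prod.fst (Prod.snd l)) (MvPolynomial.C (Prod.fst (Prod.snd (Prod.snd l))) * Option.elim (Prod.snd (Prod.snd (Prod.snd l))) 1 MvPolynomial.X) : Matrix (Fin 3) (Fin 3) (MvPolynomial σ ℝ)))).prod) (fun p => MvPolynomial.constantCoeff (MvPolynomial.pderiv v p)) : Matrix (Fin 3) (Fin 3) ℝ) * Ρ) r s := by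
      rw [k2_Dm_prod_cons, Matrix.mul_add, Matrix.add_mul, Matrix.add_apply, hhead]
      simp only [Matrix.mul_assoc]
    refine ⟨by rw [hsplit]; exact add_nonneg hhead0 ih'.1, fun h0 A l B h hv => ?_⟩
    rw [hsplit] at h0
    have htail0 : (Λ * (Matrix.transvection (Prod.fst l0) (Prod.fst (Prod.snd l0)) (Option.elim (Prod.snd (Prod.snd (Prod.snd l0))) (Prod.fst (Prod.snd (Prod.snd l0))) (fun _ => (0 : ℝ))) : Matrix (Fin 3) (Fin 3) ℝ) * (Matrix.map ((w.map (fun l => (Matrix.transvection (Prod.fst l) (Prod.fst (Prod.snd l)) (MvPolynomial.C (Prod.fst (Prod.snd (Prod.snd l))) * Option.elim (Prod.snd (Prod.snd (Prod.snd l))) 1 MvPolynomial.X) : Matrix (Fin 3) (Fin 3) (MvPolynomial σ ℝ)))).prod) (fun p => MvPolynomial.constantCoeff (MvPolynomial.pderiv v p)) : Matrix (Fin 3) (Fin 3) ℝ) * Ρ) r s = 0 := by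
      linarith [ih'.1]
    have hh0 : (Λ * (([] : List (Fin 3 × Fin 3 × ℝ × Option σ)).map (fun l => (Matrix.transvection (Prod.fst l) (Prod.fst (Prod.snd l)) (Option.elim (Prod.snd (Prod.snd (Prod.snd l))) (Prod.fst (Prod.snd (Prod.snd l))) (fun _ => (0 : ℝ))) : Matrix (Fin 3) (Fin 3) ℝ))).prod) r l0.1 * (if l0.2.2.2 = some v then l0.2.2.1 else 0) *
        ((w.map (fun l => (Matrix.transvection (Prod.fst l) (Prod.fst (Prod.snd l)) (Option.elim (Prod.snd (Prod.snd (Prod.snd l))) (Prod.fst (Prod.snd (Prod.snd l))) (fun _ => (0 : ℝ))) : Matrix (Fin 3) (Fin 3) ℝ))).prod * Ρ) l0.2.1 s = 0 := by linarith [ih'.1]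
    rcases List.cons_eq_append_iff.1 h with ⟨rfl, hB⟩ | ⟨A', rfl, hw⟩
    · -- the head letter
      cases hB
      rw [if_pos hv] at hh0
      exact hh0
    · have := ih'.2 htail0 A' l B hw hv
      simpa only [List.map_cons, List.prod_cons, Matrix.mul_assoc] using this

end Summit.ValiantsHypothesis.ValiantsHypothesis.Cruxes.WordLengthQP.PositiveMonoidExits

end
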